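import Mathlib.GroupTheory.Perm.Basic
import Mathlib.Data.Fintype.Perm
import Mathlib.Data.Fin.VecNotation
import Mathlib.Order.Monotone.Basic
import Mathlib.Data.Finset.Card
import Mathlib.Data.Fintype.Fin
import Mathlib.Data.Fintype.Prod
import Mathlib.Data.Finset.Max
import Mathlib.Order.Fin.Basic
import Mathlib.Tactic.FinCases
import Mathlib.Tactic.Set
import Mathlib.Tactic.SplitIfs
import Literature.Combinatorics.Enumerative.BruhatIntervalRookBoards
import HarnessLib

/-!
# Proof of Sjöstrand 2007, Thm 3.1 (`⇐` half): Bruhat intervals as rook boards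

This file DISCHARGES the named fact
`Literature.Combinatorics.Enumerative.Sjostrand2007_Thm_3_1` of
`Literature/Combinatorics/Enumerative/BruhatIntervalRookBoards.lean`:
`theorem Sjostrand2007_Thm_3_1_holds : Sjostrand2007_Thm_3_1` — if `π ∈ 𝔖ₙ` avoids `4231`,
`35142`, `42513`, `351624`, then there are right-aligned Ferrers boards `μ ⊆ λ` such that the
rook configurations (permutations) on `λ ∖ μ` are exactly the `σ ≤ π` in Bruhat order (rank
criterion `bruhatLE`). It adds theorems only (no definitions, no notation): the board and the
rank functions below are written out as `Finset.filter` terms.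

## Conventions

Squares are `(row, column) ∈ Fin n × Fin n`, row `0` on top; "north-east of `(i, j)`" means
row `≤ i` and column `≥ j`. For `x : Fin n → Fin n` (a rook placement with one rook per row)
and `i j : ℕ` we use the `ℕ`-indexed rank functions
* `NEₓ(i, j) = #{k : Fin n | k < i ∧ j ≤ x k}` (rooks in the rows `< i` and the columns `≥ j`;
  the statement file's `permRank x i j = x[i,j]` is `NEₓ(i + 1, j)`, `permRank_eq_neRank`),
* `SWₓ(i, j) = #{k : Fin n | i ≤ k ∧ x k < j}` (rooks in the rows `≥ i` and the columns `< j`),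
and for `π ∈ 𝔖ₙ` the board `H_R(π) = λ(π) ∖ μ(π)` (the right hull of `π`, §3 of the paper) with
* `λ(π) = {q | ∃ c, q.1 ≤ c ∧ π c ≤ q.2}` — squares with a rook of `π` weakly south-west: the
  smallest right-aligned Ferrers matrix covering `π`;
* `μ(π) = {q | ∀ c, c ≤ q.1 → π c < q.2}` — squares with no rook of `π` weakly north-east: the
  largest right-aligned Ferrers matrix avoiding `π`.

## Proof (J. Sjöstrand, JCTA 114 (2007), §4, proof of Thm 3.1, "if" direction; its last step is
the case analysis of Gasharov–Reiner, J. London Math. Soc. 66 (2002), proof of Thm 4.2)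

`μ(π) ⊆ λ(π)` and both are right-aligned Ferrers (`isRightAlignedFerrers_hullOuter/Inner`,
`hullInner_subset_hullOuter`).
* `[id, π] ⊆ 𝔖(λ ∖ μ)` (`mem_board_of_bruhatLE`, for every `π`): `σ[i, σ i] ≥ 1` forces a rook
  of `π` weakly north-east of `(i, σ i)`, and the south-west form of the rank criterion (from the
  complementary-rectangle identity `NE(i,j) + j = SW(i,j) + i`, `neRank_add_eq_swRank_add`)
  forces one weakly south-west. (The paper proves this inclusion via Prop. 4.1, "`𝔖(λ/μ)` is an
  order ideal", using that Bruhat order is generated by transpositions; with Bruhat order given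
  by the rank criterion (Björner–Brenti Thm 2.1.5 = the paper's Lemma 4.2) the direct count is
  the shorter road.)
* `𝔖(λ ∖ μ) ⊆ [id, π]` for pattern-avoiding `π` (`pattern_of_not_bruhatLE`), following the
  printed proof: if `ρ` is covered by `λ ∖ μ` and `ρ ≰ π`, the set `S = {(i,j) | ρ[i,j] > π[i,j]}`
  is nonempty and a north-east-extremal element of it lies in
  `L = {(i,j) ∈ S | no rook of π weakly right of (i,j) in row i, none weakly above in column j}`
  (`exists_mem_L`); a south-west-extremal `(I, J) ∈ L` has `I + 1 < n`, `J ≥ 1`, a rook of `π`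
  weakly right of `(I+1, J)` and one weakly above `(I, J-1)` (`exists_situation`); white rooks in
  the rectangles `R = [0,I] × [J,n)` and `R' = (I,n) × [0,J)` give black witnesses `(i, π i) ∈ R`,
  `(i', π i') ∈ R'` (board membership), and the four cases on the existence of a rook of `π` in
  `(i, I] × (π i', J)` resp. `(I, i') × [J, π i)` produce `4231`, `42513`, `35142`, `351624`
  (`contains_4231` …, explicit embeddings). Extremality is realised by minimising/maximising
  `row + (n - column)`; the printed proof also takes the second witness extremal, which the
  quadrant restriction of the two cases makes unnecessary.

## References

* J. Sjöstrand, *Bruhat intervals as rooks on skew Ferrers boards*, J. Combin. Theory Ser. A 114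
  (2007) 1182–1198, doi:10.1016/j.jcta.2007.01.001, arXiv:math/0601615 — Thm 3.1, §3 (hulls),
  §4 (Prop. 4.1, Lemma 4.2, proof of Thm 3.1). [Sjostrand2007]
* A. Björner, F. Brenti, *Combinatorics of Coxeter Groups*, GTM 231 (2005), Thm 2.1.5.
  [BjornerBrenti2005]
* V. Gasharov, V. Reiner, *Cohomology of smooth Schubert varieties in partial flag manifolds*,
  J. London Math. Soc. (2) 66 (2002) 550–562, proof of Thm 4.2 (the case analysis).
-/

namespace Literature.Combinatorics.Enumerative

namespace Sjostrand2007

open Finset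

variable {n : ℕ}

/-! ### The `ℕ`-indexed north-east rank function and its calculus -/

/-- The rank function `x[i,j]` of the statement file is `NEₓ(i + 1, j)`. [folklore] -/
theorem permRank_eq_neRank (x : Fin n → Fin n) (i j : Fin n) :
    permRank x i j = #{k : Fin n | (k : ℕ) < i + 1 ∧ j ≤ (x k : ℕ)} := by
  unfold permRank
  congr 1
  ext a
  simp only [mem_filter, mem_univ, true_and, Fin.le_def, Nat.lt_succ_iff]

/-- No rows: `NEₓ(0, j) = 0`. [folklore] -/
theorem neRank_row_zero (x : Fin n → Fin n) (j : ℕ) :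
    #{k : Fin n | (k : ℕ) < 0 ∧ j ≤ (x k : ℕ)} = 0 := by
  simp

/-- No columns `≥ n`: `NEₓ(i, j) = 0` for `j ≥ n`. [folklore] -/
theorem neRank_col_ge (x : Fin n → Fin n) (i : ℕ) {j : ℕ} (hj : n ≤ j) :
    #{k : Fin n | (k : ℕ) < i ∧ j ≤ (x k : ℕ)} = 0 := by
  simp only [card_eq_zero, filter_eq_empty_iff, mem_univ, true_implies, not_and, not_le]
  intro a _
  exact lt_of_lt_of_le (x a).isLt hj

/-- `NEₓ(i, j)` is monotone in the row bound `i`. [folklore] -/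
theorem neRank_row_mono (x : Fin n → Fin n) {i i' : ℕ} (h : i ≤ i') (j : ℕ) :
    #{k : Fin n | (k : ℕ) < i ∧ j ≤ (x k : ℕ)} ≤ #{k : Fin n | (k : ℕ) < i' ∧ j ≤ (x k : ℕ)} := by
  refine card_le_card (monotone_filter_right _ ?_)
  rintro a - ⟨h1, h2⟩
  exact ⟨lt_of_lt_of_le h1 h, h2⟩

/-- `NEₓ(i, j)` is antitone in the column bound `j`. [folklore] -/
theorem neRank_col_anti (x : Fin n → Fin n) (i : ℕ) {j j' : ℕ} (h : j ≤ j') :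
    #{k : Fin n | (k : ℕ) < i ∧ j' ≤ (x k : ℕ)} ≤ #{k : Fin n | (k : ℕ) < i ∧ j ≤ (x k : ℕ)} := by
  refine card_le_card (monotone_filter_right _ ?_)
  rintro a - ⟨h1, h2⟩
  exact ⟨h1, le_trans h h2⟩

/-- Adding row `i`: `NEₓ(i + 1, j) = NEₓ(i, j) + [j ≤ x i]`. [folklore] -/
theorem neRank_row_succ (x : Fin n → Fin n) (i : Fin n) (j : ℕ) :
    #{k : Fin n | (k : ℕ) < i + 1 ∧ j ≤ (x k : ℕ)} =
      #{k : Fin n | (k : ℕ) < i ∧ j ≤ (x k : ℕ)} + (if j ≤ (x i : ℕ) then 1 else 0) := by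
  have hsplit : univ.filter (fun a : Fin n => (a : ℕ) < i + 1 ∧ j ≤ (x a : ℕ))
      = univ.filter (fun a : Fin n => (a : ℕ) < i ∧ j ≤ (x a : ℕ))
        ∪ univ.filter (fun a : Fin n => a = i ∧ j ≤ (x a : ℕ)) := by
    ext a
    simp only [mem_filter, mem_univ, true_and, mem_union, Fin.ext_iff]
    omega
  rw [hsplit, card_union_of_disjoint]
  · congr 1
    by_cases h : j ≤ (x i : ℕ)
    · rw [if_pos h, card_eq_one]
      refine ⟨i, ?_⟩
      ext a
      simp only [mem_filter, mem_univ, true_and, mem_singleton]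
      constructor
      · rintro ⟨h1, _⟩; exact h1
      · rintro rfl; exact ⟨rfl, h⟩
    · rw [if_neg h, card_eq_zero, filter_eq_empty_iff]
      rintro a - ⟨rfl, h2⟩
      exact h h2
  · rw [disjoint_filter]
    rintro a - ⟨h1, -⟩ ⟨h2, -⟩
    rw [h2] at h1
    exact lt_irrefl _ h1

/-- Removing column `j` (for a permutation `σ`): `NE_σ(i, j) = NE_σ(i, j + 1) + [σ⁻¹ j < i]`.
[folklore] -/
theorem neRank_col_succ (σ : Equiv.Perm (Fin n)) (i : ℕ) (j : Fin n) :
    #{k : Fin n | (k : ℕ) < i ∧ j ≤ (σ k : ℕ)} =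
      #{k : Fin n | (k : ℕ) < i ∧ j + 1 ≤ (σ k : ℕ)} + (if (σ.symm j : ℕ) < i then 1 else 0) := by
  have hsplit : univ.filter (fun a : Fin n => (a : ℕ) < i ∧ (j : ℕ) ≤ (σ a : ℕ))
      = univ.filter (fun a : Fin n => (a : ℕ) < i ∧ (j : ℕ) + 1 ≤ (σ a : ℕ))
        ∪ univ.filter (fun a : Fin n => (a : ℕ) < i ∧ σ a = j) := by
    ext a
    simp only [mem_filter, mem_univ, true_and, mem_union, Fin.ext_iff]
    omega
  rw [hsplit, card_union_of_disjoint]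
  · congr 1
    by_cases h : (σ.symm j : ℕ) < i
    · rw [if_pos h, card_eq_one]
      refine ⟨σ.symm j, ?_⟩
      ext a
      simp only [mem_filter, mem_univ, true_and, mem_singleton]
      constructor
      · rintro ⟨_, h2⟩
        rw [← h2, Equiv.symm_apply_apply]
      · rintro rfl
        exact ⟨h, Equiv.apply_symm_apply _ _⟩
    · rw [if_neg h, card_eq_zero, filter_eq_empty_iff]
      rintro a - ⟨h1, h2⟩
      apply h
      rw [← h2, Equiv.symm_apply_apply]
      exact h1
  · rw [disjoint_filter]
    rintro a - ⟨-, h1⟩ ⟨-, h2⟩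
    rw [h2] at h1
    omega

/-- `#{k : k < i} = i` for `i ≤ n` (`Fin.card_filter_val_lt`). [folklore] -/
theorem card_filter_row_lt {i : ℕ} (hi : i ≤ n) :
    (univ.filter (fun a : Fin n => (a : ℕ) < i)).card = i := by
  rw [Fin.card_filter_val_lt, Nat.min_eq_right hi]

/-- `#{k : σ k < j} = j` for a permutation `σ` and `j ≤ n`. [folklore] -/
theorem card_filter_val_lt_perm (σ : Equiv.Perm (Fin n)) {j : ℕ} (hj : j ≤ n) :
    (univ.filter (fun a : Fin n => (σ a : ℕ) < j)).card = j := by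
  have h : (univ.filter (fun a : Fin n => (σ a : ℕ) < j)).card
      = (univ.filter (fun a : Fin n => (a : ℕ) < j)).card := by
    refine card_equiv σ ?_
    intro a
    simp
  rw [h, card_filter_row_lt hj]

/-- The complementary-rectangle identity for a permutation `σ` and `i, j ≤ n`:
`NE_σ(i, j) + j = SW_σ(i, j) + i` (both sides are `#{k < i} + #{k : σ k < j}` minus the size of
the north-west rectangle; Sjöstrand 2007, proof of Thm 3.1: "Since there are more white than
black rooks inside the rectangle `R` … there must also be more white than black rooks inside the
diagonally opposite rectangle `R'`"). [folklore] -/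
theorem neRank_add_eq_swRank_add (σ : Equiv.Perm (Fin n)) {i j : ℕ} (hi : i ≤ n) (hj : j ≤ n) :
    #{k : Fin n | (k : ℕ) < i ∧ j ≤ (σ k : ℕ)} + j =
      #{k : Fin n | i ≤ (k : ℕ) ∧ (σ k : ℕ) < j} + i := by
  have h1 : #{k : Fin n | (k : ℕ) < i ∧ j ≤ (σ k : ℕ)} +
      (univ.filter (fun a : Fin n => (a : ℕ) < i ∧ (σ a : ℕ) < j)).card = i := by
    have h := card_filter_add_card_filter_not (s := univ.filter (fun a : Fin n => (a : ℕ) < i))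
      (fun a : Fin n => j ≤ (σ a : ℕ))
    rw [filter_filter, filter_filter, card_filter_row_lt hi] at h
    simpa only [not_le] using h
  have h2 : #{k : Fin n | i ≤ (k : ℕ) ∧ (σ k : ℕ) < j} +
      (univ.filter (fun a : Fin n => (a : ℕ) < i ∧ (σ a : ℕ) < j)).card = j := by
    have h := card_filter_add_card_filter_not (s := univ.filter (fun a : Fin n => (σ a : ℕ) < j))
      (fun a : Fin n => i ≤ (a : ℕ))
    have e1 : univ.filter (fun a : Fin n => (σ a : ℕ) < j ∧ i ≤ (a : ℕ))
        = univ.filter (fun a : Fin n => i ≤ (a : ℕ) ∧ (σ a : ℕ) < j) := by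
      ext a; simp only [mem_filter, mem_univ, true_and]; exact and_comm
    have e2 : univ.filter (fun a : Fin n => (σ a : ℕ) < j ∧ ¬ i ≤ (a : ℕ))
        = univ.filter (fun a : Fin n => (a : ℕ) < i ∧ (σ a : ℕ) < j) := by
      ext a; simp only [mem_filter, mem_univ, true_and, not_le]; exact and_comm
    rw [filter_filter, filter_filter, card_filter_val_lt_perm σ hj, e1, e2] at h
    exact h
  omega

/-- All rows: `NE_σ(n, j) = n - j` for a permutation `σ`. [folklore] -/
theorem neRank_row_n (σ : Equiv.Perm (Fin n)) {j : ℕ} (hj : j ≤ n) :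
    #{k : Fin n | (k : ℕ) < n ∧ j ≤ (σ k : ℕ)} = n - j := by
  have h := neRank_add_eq_swRank_add σ le_rfl hj
  have h0 : #{k : Fin n | n ≤ (k : ℕ) ∧ (σ k : ℕ) < j} = 0 := by
    simp only [card_eq_zero, filter_eq_empty_iff, mem_univ, true_implies, not_and]
    intro a ha
    exact absurd a.isLt (not_lt.mpr ha)
  omega

/-- No rows `≥ n`: `NEₓ(i, j) = NEₓ(n, j)` for `i ≥ n`. [folklore] -/
theorem neRank_row_ge (x : Fin n → Fin n) {i : ℕ} (hi : n ≤ i) (j : ℕ) :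
    #{k : Fin n | (k : ℕ) < i ∧ j ≤ (x k : ℕ)} = #{k : Fin n | (k : ℕ) < n ∧ j ≤ (x k : ℕ)} := by
  congr 1
  ext a
  simp only [mem_filter, mem_univ, true_and]
  constructor
  · rintro ⟨-, h2⟩; exact ⟨a.isLt, h2⟩
  · rintro ⟨-, h2⟩; exact ⟨lt_of_lt_of_le a.isLt hi, h2⟩

/-- The rank criterion `bruhatLE σ π` extends to all `ℕ`-indexed ranks: `NE_σ(i, j) ≤ NE_π(i, j)`.
[folklore] -/
theorem neRank_le_of_bruhatLE {σ π : Equiv.Perm (Fin n)} (h : bruhatLE σ π) (i j : ℕ) :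
    #{k : Fin n | (k : ℕ) < i ∧ j ≤ (σ k : ℕ)} ≤ #{k : Fin n | (k : ℕ) < i ∧ j ≤ (π k : ℕ)} := by
  rcases Nat.lt_or_ge j n with hj | hj
  · rcases Nat.eq_zero_or_pos i with rfl | hi
    · simp
    · rcases Nat.lt_or_ge n i with hin | hin
      · rw [neRank_row_ge σ hin.le, neRank_row_ge π hin.le, neRank_row_n σ hj.le,
          neRank_row_n π hj.le]
      · obtain ⟨i₀, rfl⟩ : ∃ i₀, i = i₀ + 1 := ⟨i - 1, by omega⟩
        have := h ⟨i₀, by omega⟩ ⟨j, hj⟩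
        rwa [permRank_eq_neRank, permRank_eq_neRank] at this
  · rw [neRank_col_ge σ i hj, neRank_col_ge π i hj]

/-- South-west form of the rank criterion: `σ ≤ π` implies `SW_σ(i, j) ≤ SW_π(i, j)`
(Björner–Brenti 2005, proof of Thm 2.1.5; here from `neRank_add_eq_swRank_add`). [folklore] -/
theorem swRank_le_of_bruhatLE {σ π : Equiv.Perm (Fin n)} (h : bruhatLE σ π) {i j : ℕ}
    (hi : i ≤ n) (hj : j ≤ n) :
    #{k : Fin n | i ≤ (k : ℕ) ∧ (σ k : ℕ) < j} ≤ #{k : Fin n | i ≤ (k : ℕ) ∧ (π k : ℕ) < j} := by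
  have h1 := neRank_add_eq_swRank_add σ hi hj
  have h2 := neRank_add_eq_swRank_add π hi hj
  have h3 := neRank_le_of_bruhatLE h i j
  omega

/-! ### The board `λ(π) ∖ μ(π)` (the right hull of `π`) -/

/-- `λ(π)` is a right-aligned Ferrers matrix. [cite: Sjostrand2007, §3] -/
theorem isRightAlignedFerrers_hullOuter (π : Equiv.Perm (Fin n)) :
    IsRightAlignedFerrers (univ.filter fun q : Fin n × Fin n => ∃ c, q.1 ≤ c ∧ π c ≤ q.2) := by
  intro i j hij
  simp only [mem_filter, mem_univ, true_and] at hij ⊢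
  obtain ⟨a, ha1, ha2⟩ := hij
  exact ⟨fun j' hj' => ⟨a, ha1, le_trans ha2 hj'⟩, fun i' hi' => ⟨a, le_trans hi' ha1, ha2⟩⟩

/-- `μ(π)` is a right-aligned Ferrers matrix. [cite: Sjostrand2007, §3] -/
theorem isRightAlignedFerrers_hullInner (π : Equiv.Perm (Fin n)) :
    IsRightAlignedFerrers (univ.filter fun q : Fin n × Fin n => ∀ c, c ≤ q.1 → π c < q.2) := by
  intro i j hij
  simp only [mem_filter, mem_univ, true_and] at hij ⊢
  exact ⟨fun j' hj' a ha => lt_of_lt_of_le (hij a ha) hj',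
    fun i' hi' a ha => hij a (le_trans ha hi')⟩

/-- `μ(π) ⊆ λ(π)` (the rook of row `i` witnesses it). [cite: Sjostrand2007, §3] -/
theorem hullInner_subset_hullOuter (π : Equiv.Perm (Fin n)) :
    (univ.filter fun q : Fin n × Fin n => ∀ c, c ≤ q.1 → π c < q.2) ⊆
      (univ.filter fun q : Fin n × Fin n => ∃ c, q.1 ≤ c ∧ π c ≤ q.2) := by
  intro p hp
  simp only [mem_filter, mem_univ, true_and] at hp ⊢
  exact ⟨p.1, le_rfl, (hp p.1 le_rfl).le⟩

/-- Membership in the right hull `λ(π) ∖ μ(π)`: a rook of `π` weakly south-west and one weakly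
north-east. [cite: Sjostrand2007, §3] -/
theorem mem_board_iff (π : Equiv.Perm (Fin n)) (a b : Fin n) :
    (a, b) ∈ (univ.filter fun q : Fin n × Fin n => ∃ c, q.1 ≤ c ∧ π c ≤ q.2) \
        (univ.filter fun q : Fin n × Fin n => ∀ c, c ≤ q.1 → π c < q.2) ↔
      (∃ c : Fin n, a ≤ c ∧ π c ≤ b) ∧ (∃ c : Fin n, c ≤ a ∧ b ≤ π c) := by
  simp only [mem_sdiff, mem_filter, mem_univ, true_and, not_forall, not_lt, exists_prop]

/-! ### `[id, π] ⊆ 𝔖(λ ∖ μ)` -/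

/-- `[id, π] ⊆ 𝔖(H_R(π))`: every `σ ≤ π` is a rook configuration on `λ(π) ∖ μ(π)` (for every
`π`; Sjöstrand 2007, Prop. 4.1 with `π ∈ 𝔖(H_R(π))` — proved here directly from the rank
criterion and its south-west form). [cite: Sjostrand2007, Prop 4.1] -/
theorem mem_board_of_bruhatLE {σ π : Equiv.Perm (Fin n)} (h : bruhatLE σ π) (a : Fin n) :
    (a, σ a) ∈ (univ.filter fun q : Fin n × Fin n => ∃ c, q.1 ≤ c ∧ π c ≤ q.2) \
      (univ.filter fun q : Fin n × Fin n => ∀ c, c ≤ q.1 → π c < q.2) := by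
  rw [mem_board_iff]
  constructor
  · -- a rook of `π` weakly south-west of `(a, σ a)`, by the SW form of the rank criterion
    by_contra H
    simp only [not_exists, not_and, not_le] at H
    have hle := swRank_le_of_bruhatLE h (i := a) (j := (σ a : ℕ) + 1) a.isLt.le (by omega)
    have h1 : 1 ≤ #{k : Fin n | a ≤ (k : ℕ) ∧ (σ k : ℕ) < (σ a : ℕ) + 1} := by
      rw [Nat.one_le_iff_ne_zero, Ne, card_eq_zero, ← Ne, ← nonempty_iff_ne_empty]
      exact ⟨a, by simp⟩
    have h2 : #{k : Fin n | a ≤ (k : ℕ) ∧ (π k : ℕ) < (σ a : ℕ) + 1} = 0 := by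
      rw [card_eq_zero, filter_eq_empty_iff]
      rintro c - ⟨h1, h2⟩
      have := H c (Fin.le_def.mpr h1)
      rw [Fin.lt_def] at this
      omega
    omega
  · -- a rook of `π` weakly north-east of `(a, σ a)`, by the rank criterion at `(a, σ a)`
    have hle := h a (σ a)
    have h1 : 1 ≤ permRank σ a (σ a) := by
      unfold permRank
      rw [Nat.one_le_iff_ne_zero, Ne, card_eq_zero, ← Ne, ← nonempty_iff_ne_empty]
      exact ⟨a, by simp⟩
    have h2 : 0 < permRank π a (σ a) := by omega
    unfold permRank at h2
    rw [card_pos] at h2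
    obtain ⟨c, hc⟩ := h2
    simp only [mem_filter, mem_univ, true_and] at hc
    exact ⟨c, hc.1, hc.2⟩

/-! ### Pattern embeddings -/

/-- Rows `r₀ < r₁ < r₂ < r₃` with values in relative order `4 2 3 1` give the pattern `4231`.
[folklore] -/
theorem contains_4231 (π : Equiv.Perm (Fin n)) (r0 r1 r2 r3 : Fin n)
    (h01 : r0 < r1) (h12 : r1 < r2) (h23 : r2 < r3)
    (v31 : π r3 < π r1) (v12 : π r1 < π r2) (v20 : π r2 < π r0) :
    PermContainsPattern π ![4, 2, 3, 1] := by
  refine ⟨![r0, r1, r2, r3], Fin.strictMono_iff_lt_succ.mpr ?_, ?_⟩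
  · intro a
    fin_cases a <;> simp <;> omega
  · intro a b
    fin_cases a <;> fin_cases b <;> simp <;> omega

/-- Rows `r₀ < ⋯ < r₄` with values in relative order `3 5 1 4 2` give the pattern `35142`.
[folklore] -/
theorem contains_35142 (π : Equiv.Perm (Fin n)) (r0 r1 r2 r3 r4 : Fin n)
    (h01 : r0 < r1) (h12 : r1 < r2) (h23 : r2 < r3) (h34 : r3 < r4)
    (v24 : π r2 < π r4) (v40 : π r4 < π r0) (v03 : π r0 < π r3) (v31 : π r3 < π r1) :
    PermContainsPattern π ![3, 5, 1, 4, 2] := by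
  refine ⟨![r0, r1, r2, r3, r4], Fin.strictMono_iff_lt_succ.mpr ?_, ?_⟩
  · intro a
    fin_cases a <;> simp <;> omega
  · intro a b
    fin_cases a <;> fin_cases b <;> simp <;> omega

/-- Rows `r₀ < ⋯ < r₄` with values in relative order `4 2 5 1 3` give the pattern `42513`.
[folklore] -/
theorem contains_42513 (π : Equiv.Perm (Fin n)) (r0 r1 r2 r3 r4 : Fin n)
    (h01 : r0 < r1) (h12 : r1 < r2) (h23 : r2 < r3) (h34 : r3 < r4)
    (v31 : π r3 < π r1) (v14 : π r1 < π r4) (v40 : π r4 < π r0) (v02 : π r0 < π r2) :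
    PermContainsPattern π ![4, 2, 5, 1, 3] := by
  refine ⟨![r0, r1, r2, r3, r4], Fin.strictMono_iff_lt_succ.mpr ?_, ?_⟩
  · intro a
    fin_cases a <;> simp <;> omega
  · intro a b
    fin_cases a <;> fin_cases b <;> simp <;> omega

/-- Rows `r₀ < ⋯ < r₅` with values in relative order `3 5 1 6 2 4` give the pattern `351624`.
[folklore] -/
theorem contains_351624 (π : Equiv.Perm (Fin n)) (r0 r1 r2 r3 r4 r5 : Fin n)
    (h01 : r0 < r1) (h12 : r1 < r2) (h23 : r2 < r3) (h34 : r3 < r4) (h45 : r4 < r5)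
    (v24 : π r2 < π r4) (v40 : π r4 < π r0) (v05 : π r0 < π r5) (v51 : π r5 < π r1)
    (v13 : π r1 < π r3) :
    PermContainsPattern π ![3, 5, 1, 6, 2, 4] := by
  refine ⟨![r0, r1, r2, r3, r4, r5], Fin.strictMono_iff_lt_succ.mpr ?_, ?_⟩
  · intro a
    fin_cases a <;> simp <;> omega
  · intro a b
    fin_cases a <;> fin_cases b <;> simp <;> omega

/-! ### The "if" direction: a rook configuration on `λ ∖ μ` outside `[id, π]` forces a pattern -/

section MainArgument

variable (π ρ : Equiv.Perm (Fin n))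

/-- Step 1 (the set `L` is not empty): if `ρ ≰ π` there is a square `(i, j)` with
`ρ[i,j] > π[i,j]`, no rook of `π` weakly to its right in row `i` and none weakly above it in
column `j` — namely any north-east-extremal square with `ρ[i,j] > π[i,j]`.
[cite: Sjostrand2007, §4 (proof of Thm 3.1)] -/
theorem exists_mem_L (h : ¬ bruhatLE ρ π) :
    ∃ i j : Fin n, permRank π i j < permRank ρ i j ∧ π i < j ∧ i < π.symm j := by
  classical
  -- the set `S` of squares where the rank criterion fails, and a north-east-extremal element
  set S : Finset (Fin n × Fin n) :=
    univ.filter (fun p => permRank π p.1 p.2 < permRank ρ p.1 p.2) with hS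
  have hSne : S.Nonempty := by
    simp only [bruhatLE, not_forall, not_le] at h
    obtain ⟨i, j, hij⟩ := h
    exact ⟨(i, j), by simp [hS, hij]⟩
  obtain ⟨⟨i, j⟩, hmem, hmin⟩ :=
    S.exists_min_image (fun p : Fin n × Fin n => (p.1 : ℕ) + (n - (p.2 : ℕ))) hSne
  simp only [hS, mem_filter, mem_univ, true_and] at hmem hmin
  refine ⟨i, j, hmem, ?_, ?_⟩
  · -- no rook of `π` weakly to the right of `(i, j)` in row `i`
    by_contra H
    rw [not_lt] at H
    have hπ : permRank π i j = #{k : Fin n | (k : ℕ) < i ∧ j ≤ (π k : ℕ)} + 1 := by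
      rw [permRank_eq_neRank, neRank_row_succ, if_pos (Fin.le_def.mp H)]
    have hρ : permRank ρ i j ≤ #{k : Fin n | (k : ℕ) < i ∧ j ≤ (ρ k : ℕ)} + 1 := by
      rw [permRank_eq_neRank, neRank_row_succ]
      split_ifs <;> omega
    rcases Nat.eq_zero_or_pos (i : ℕ) with hi | hi
    · rw [hi, neRank_row_zero] at hπ hρ
      omega
    · -- the square `(i - 1, j)` is a smaller element of `S`
      set i₀ : Fin n := ⟨(i : ℕ) - 1, by omega⟩ with hi₀
      have hi₀v : (i₀ : ℕ) = (i : ℕ) - 1 := rfl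
      have hi₀' : (i : ℕ) = (i₀ : ℕ) + 1 := by omega
      have hlt : permRank π i₀ j < permRank ρ i₀ j := by
        rw [permRank_eq_neRank, permRank_eq_neRank, ← hi₀']
        omega
      have := hmin (i₀, j) hlt
      dsimp only at this
      omega
  · -- no rook of `π` weakly above `(i, j)` in column `j`
    by_contra H
    rw [not_lt] at H
    have hπ : permRank π i j = #{k : Fin n | (k : ℕ) < i + 1 ∧ j + 1 ≤ (π k : ℕ)} + 1 := by
      rw [permRank_eq_neRank, neRank_col_succ,
        if_pos (by exact Nat.lt_succ_of_le (Fin.le_def.mp H))]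
    have hρ : permRank ρ i j ≤ #{k : Fin n | (k : ℕ) < i + 1 ∧ j + 1 ≤ (ρ k : ℕ)} + 1 := by
      rw [permRank_eq_neRank, neRank_col_succ]
      split_ifs <;> omega
    rcases Nat.lt_or_ge ((j : ℕ) + 1) n with hj | hj
    · -- the square `(i, j + 1)` is a smaller element of `S`
      set j₁ : Fin n := ⟨(j : ℕ) + 1, hj⟩ with hj₁
      have hj₁v : (j₁ : ℕ) = (j : ℕ) + 1 := rfl
      have hlt : permRank π i j₁ < permRank ρ i j₁ := by
        rw [permRank_eq_neRank, permRank_eq_neRank, hj₁v]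
        omega
      have := hmin (i, j₁) hlt
      dsimp only at this
      omega
    · rw [neRank_col_ge π _ hj] at hπ
      rw [neRank_col_ge ρ _ hj] at hρ
      omega

/-- Step 2 (a maximal square of `L` and its neighbours): there is a square `(I, J) ∈ L` with
`I + 1 < n`, `1 ≤ J`, a rook of `π` weakly to the right of `(I+1, J)` in row `I + 1` and a rook
of `π` weakly above `(I, J-1)` in column `J - 1` — namely any south-west-extremal square of `L`.
[cite: Sjostrand2007, §4 (proof of Thm 3.1)] -/
theorem exists_situation (h : ¬ bruhatLE ρ π) :
    ∃ I J I₁ J₁ : Fin n, (I₁ : ℕ) = I + 1 ∧ (J₁ : ℕ) + 1 = J ∧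
      permRank π I J < permRank ρ I J ∧ π I < J ∧ I < π.symm J ∧ J ≤ π I₁ ∧ π.symm J₁ ≤ I := by
  classical
  set L : Finset (Fin n × Fin n) := univ.filter
    (fun p => permRank π p.1 p.2 < permRank ρ p.1 p.2 ∧ π p.1 < p.2 ∧ p.1 < π.symm p.2) with hL
  have hLne : L.Nonempty := by
    obtain ⟨i, j, h1, h2, h3⟩ := exists_mem_L π ρ h
    exact ⟨(i, j), by simp [hL, h1, h2, h3]⟩
  obtain ⟨⟨I, J⟩, hmem, hmax⟩ :=
    L.exists_max_image (fun p : Fin n × Fin n => (p.1 : ℕ) + (n - (p.2 : ℕ))) hLne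
  simp only [hL, mem_filter, mem_univ, true_and] at hmem hmax
  obtain ⟨hlt, hrow, hcol⟩ := hmem
  have hI : (I : ℕ) + 1 < n := by
    have h1 := Fin.lt_def.mp hcol
    have h2 := (π.symm J).isLt
    omega
  have hJ : 1 ≤ (J : ℕ) := by
    have h1 := Fin.lt_def.mp hrow
    omega
  set I₁ : Fin n := ⟨(I : ℕ) + 1, hI⟩ with hI₁
  set J₁ : Fin n := ⟨(J : ℕ) - 1, by omega⟩ with hJ₁
  have hI₁v : (I₁ : ℕ) = (I : ℕ) + 1 := rfl
  have hJ₁v : (J₁ : ℕ) = (J : ℕ) - 1 := rfl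
  refine ⟨I, J, I₁, J₁, hI₁v, by omega, hlt, hrow, hcol, ?_, ?_⟩
  · -- a rook of `π` weakly to the right of `(I + 1, J)`; else `(I + 1, J) ∈ L` is larger
    by_contra H
    rw [not_le] at H
    have h1 : permRank π I₁ J < permRank ρ I₁ J := by
      have e1 : permRank π I₁ J = permRank π I J := by
        rw [permRank_eq_neRank, permRank_eq_neRank, neRank_row_succ,
          if_neg (not_le.mpr (Fin.lt_def.mp H)), add_zero]
      have e2 : permRank ρ I J ≤ permRank ρ I₁ J := by
        rw [permRank_eq_neRank, permRank_eq_neRank]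
        exact neRank_row_mono ρ (by omega) _
      omega
    have h2 : π I₁ < J := H
    have h3 : I₁ < π.symm J := by
      rcases lt_or_eq_of_le (show I₁ ≤ π.symm J from Fin.lt_def.mp hcol) with h' | h'
      · exact h'
      · exfalso
        have : π I₁ = J := by rw [h', Equiv.apply_symm_apply]
        exact absurd this (ne_of_lt H)
    have := hmax (I₁, J) ⟨h1, h2, h3⟩
    dsimp only at this
    omega
  · -- a rook of `π` weakly above `(I, J - 1)`; else `(I, J - 1) ∈ L` is larger
    by_contra H
    rw [not_le] at H
    have h1 : permRank π I J₁ < permRank ρ I J₁ := by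
      have e1 : permRank π I J₁ = permRank π I J := by
        rw [permRank_eq_neRank, permRank_eq_neRank, neRank_col_succ π _ J₁, if_neg, add_zero]
        · rw [show (J₁ : ℕ) + 1 = J by omega]
        · simp only [not_lt]
          exact Fin.lt_def.mp H
      have e2 : permRank ρ I J ≤ permRank ρ I J₁ := by
        rw [permRank_eq_neRank, permRank_eq_neRank]
        exact neRank_col_anti ρ _ (by omega)
      omega
    have h2 : π I < J₁ := by
      rcases lt_or_eq_of_le (show π I ≤ J₁ from by
          rw [Fin.le_def]; have := Fin.lt_def.mp hrow; omega) with h' | h'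
      · exact h'
      · exfalso
        have : π.symm J₁ = I := by rw [← h', Equiv.symm_apply_apply]
        rw [this] at H
        exact lt_irrefl _ H
    have h3 : I < π.symm J₁ := H
    have := hmax (I, J₁) ⟨h1, h2, h3⟩
    dsimp only at this
    omega

/-- Steps 3–4 (the witnesses and the Gasharov–Reiner case analysis): a rook configuration `ρ` on
`λ(π) ∖ μ(π)` (hypothesis `hcov`, in the unfolded form of `mem_board_iff`) with `ρ ≰ π` forces
one of the four patterns in `π`. [cite: Sjostrand2007, §4 (proof of Thm 3.1)] -/
theorem pattern_of_not_bruhatLE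
    (hcov : ∀ a : Fin n, (∃ c : Fin n, a ≤ c ∧ π c ≤ ρ a) ∧ (∃ c : Fin n, c ≤ a ∧ ρ a ≤ π c))
    (h : ¬ bruhatLE ρ π) :
    PermContainsPattern π ![4, 2, 3, 1] ∨ PermContainsPattern π ![3, 5, 1, 4, 2] ∨
      PermContainsPattern π ![4, 2, 5, 1, 3] ∨ PermContainsPattern π ![3, 5, 1, 6, 2, 4] := by
  classical
  obtain ⟨I, J, I₁, J₁, hI₁, hJ₁, hlt, hrow, hcol, hB, hD⟩ := exists_situation π ρ h
  -- first witness: a rook `(i, π i)` of `π` in `R = [0, I] × [J, n)` (a white rook lies in `R`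
  -- since `ρ[I,J] > 0`, and it is not in `μ`)
  obtain ⟨i, hiI, hJi⟩ : ∃ i : Fin n, i ≤ I ∧ J ≤ π i := by
    have h1 : 0 < permRank ρ I J := by omega
    unfold permRank at h1
    rw [card_pos] at h1
    obtain ⟨a, ha⟩ := h1
    simp only [mem_filter, mem_univ, true_and] at ha
    obtain ⟨-, ⟨e, he1, he2⟩⟩ := hcov a
    exact ⟨e, le_trans he1 ha.1, le_trans ha.2 he2⟩
  -- second witness: a rook `(i', π i')` of `π` in `R' = (I, n) × [0, J)` (a white rook lies
  -- in `R'` by the complementary-rectangle identity, and it is in `λ`).  (The printed proof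
  -- takes it north-east-extremal; restricting `P`, `Q` below to a quadrant makes that unnecessary.)
  obtain ⟨i', hIi', hi'J⟩ : ∃ i' : Fin n, I < i' ∧ π i' < J := by
    have hsw : 0 < #{k : Fin n | (I : ℕ) + 1 ≤ (k : ℕ) ∧ (ρ k : ℕ) < J} := by
      have e1 := neRank_add_eq_swRank_add ρ (i := (I : ℕ) + 1) (j := J) (by omega) J.isLt.le
      have e2 := neRank_add_eq_swRank_add π (i := (I : ℕ) + 1) (j := J) (by omega) J.isLt.le
      rw [permRank_eq_neRank, permRank_eq_neRank] at hlt
      omega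
    rw [card_pos] at hsw
    obtain ⟨a, ha⟩ := hsw
    simp only [mem_filter, mem_univ, true_and] at ha
    obtain ⟨⟨b, hb1, hb2⟩, -⟩ := hcov a
    refine ⟨b, ?_, ?_⟩
    · rw [Fin.lt_def]; have := Fin.le_def.mp hb1; omega
    · rw [Fin.lt_def]; have := Fin.le_def.mp hb2; omega
  -- the rooks of `π` in the columns `J`, `J - 1` sit in the rows `c > I`, `d ≤ I`
  set c := π.symm J with hc
  set d := π.symm J₁ with hd
  have hπc : π c = J := by simp [hc]
  have hπd : π d = J₁ := by simp [hd]
  -- elementary order relations between the marked rooks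
  have hJ₁J : J₁ < J := by rw [Fin.lt_def]; omega
  have hII₁ : I < I₁ := by rw [Fin.lt_def, hI₁]; exact Nat.lt_succ_self _
  have hiI' : i < I := by
    rcases lt_or_eq_of_le hiI with h' | h'
    · exact h'
    · exfalso; rw [h'] at hJi; exact lt_irrefl _ (lt_of_le_of_lt hJi hrow)
  have hI₁i' : I₁ < i' := by
    have h1 : I₁ ≤ i' := by rw [Fin.le_def, hI₁]; exact Fin.lt_def.mp hIi'
    rcases lt_or_eq_of_le h1 with h' | h'
    · exact h'
    · exfalso; rw [h'] at hB; exact lt_irrefl _ (lt_of_le_of_lt hB hi'J)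
  have hJi' : J < π i := by
    rcases lt_or_eq_of_le hJi with h' | h'
    · exact h'
    · exfalso
      have : c = i := by rw [hc, h', Equiv.symm_apply_apply]
      rw [← this] at hiI
      exact lt_irrefl _ (lt_of_lt_of_le hcol hiI)
  have hi'J₁ : π i' < J₁ := by
    have h1 : π i' ≤ J₁ := by rw [Fin.le_def]; have := Fin.lt_def.mp hi'J; omega
    rcases lt_or_eq_of_le h1 with h' | h'
    · exact h'
    · exfalso
      have : d = i' := by rw [hd, ← h', Equiv.symm_apply_apply]
      rw [← this] at hIi'
      exact lt_irrefl _ (lt_of_lt_of_le hIi' hD)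
  -- `P`: a rook of `π` in the rows `(i, I]` and the columns `(π i', J)`;
  -- `Q`: a rook of `π` in the rows `(I, i')` and the columns `[J, π i)`.
  -- Without `Q`, the rooks in row `I + 1` and in column `J` lie outside the witnesses' rectangle:
  have hB' : (¬ ∃ q : Fin n, I < q ∧ q < i' ∧ J ≤ π q ∧ π q < π i) → π i < π I₁ := by
    intro hQ
    by_contra H
    rcases lt_or_eq_of_le (not_lt.mp H) with h' | h'
    · exact hQ ⟨I₁, hII₁, hI₁i', hB, h'⟩
    · have : I₁ = i := π.injective h'
      rw [this] at hII₁
      exact lt_irrefl _ (lt_trans hiI' hII₁)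
  have hc' : (¬ ∃ q : Fin n, I < q ∧ q < i' ∧ J ≤ π q ∧ π q < π i) → i' < c := by
    intro hQ
    by_contra H
    rcases lt_or_eq_of_le (not_lt.mp H) with h' | h'
    · exact hQ ⟨c, hcol, h', by rw [hπc], by rw [hπc]; exact hJi'⟩
    · rw [h'] at hπc
      rw [hπc] at hi'J
      exact lt_irrefl _ hi'J
  -- Without `P`, the rooks in column `J - 1` and in row `I` lie outside the rectangle:
  have hd' : (¬ ∃ p : Fin n, i < p ∧ p ≤ I ∧ π i' < π p ∧ π p < J) → d < i := by
    intro hP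
    by_contra H
    rcases lt_or_eq_of_le (not_lt.mp H) with h' | h'
    · exact hP ⟨d, h', hD, by rw [hπd]; exact hi'J₁, by rw [hπd]; exact hJ₁J⟩
    · rw [h', hπd] at hJi'
      exact lt_irrefl _ (lt_trans hJ₁J hJi')
  have hA' : (¬ ∃ p : Fin n, i < p ∧ p ≤ I ∧ π i' < π p ∧ π p < J) → π I < π i' := by
    intro hP
    by_contra H
    rcases lt_or_eq_of_le (not_lt.mp H) with h' | h'
    · exact hP ⟨I, hiI', le_rfl, h', hrow⟩
    · have : i' = I := π.injective h'
      rw [this] at hIi'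
      exact lt_irrefl _ hIi'
  -- The four cases of Gasharov–Reiner
  by_cases hP : ∃ p : Fin n, i < p ∧ p ≤ I ∧ π i' < π p ∧ π p < J
  · obtain ⟨p, hip, hpI, hi'p, hpJ⟩ := hP
    by_cases hQ : ∃ q : Fin n, I < q ∧ q < i' ∧ J ≤ π q ∧ π q < π i
    · -- `P` and `Q`: the pattern `4231` on the rows `i < p < q < i'`
      obtain ⟨q, hIq, hqi', hJq, hqi⟩ := hQ
      exact Or.inl (contains_4231 π i p q i' hip (lt_of_le_of_lt hpI hIq) hqi' hi'p
        (lt_of_lt_of_le hpJ hJq) hqi)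
    · -- `P` only: the pattern `42513` on the rows `i < p < I + 1 < i' < c`
      refine Or.inr (Or.inr (Or.inl ?_))
      exact contains_42513 π i p I₁ i' c hip (lt_of_le_of_lt hpI hII₁) hI₁i' (hc' hQ)
        hi'p (by rw [hπc]; exact hpJ) (by rw [hπc]; exact hJi') (hB' hQ)
  · by_cases hQ : ∃ q : Fin n, I < q ∧ q < i' ∧ J ≤ π q ∧ π q < π i
    · -- `Q` only: the pattern `35142` on the rows `d < i < I < q < i'`
      obtain ⟨q, hIq, hqi', hJq, hqi⟩ := hQ
      refine Or.inr (Or.inl ?_)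
      exact contains_35142 π d i I q i' (hd' hP) hiI' hIq hqi'
        (hA' hP) (by rw [hπd]; exact hi'J₁) (by rw [hπd]; exact lt_of_lt_of_le hJ₁J hJq) hqi
    · -- neither: the pattern `351624` on the rows `d < i < I < I + 1 < i' < c`
      refine Or.inr (Or.inr (Or.inr ?_))
      exact contains_351624 π d i I I₁ i' c (hd' hP) hiI' hII₁ hI₁i' (hc' hQ)
        (hA' hP) (by rw [hπd]; exact hi'J₁) (by rw [hπd, hπc]; exact hJ₁J)
        (by rw [hπc]; exact hJi') (hB' hQ)

end MainArgument

end Sjostrand2007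

open Finset Sjostrand2007 in
/-- **Sjöstrand 2007, Thm 3.1 (`⇐` half)**, discharging the named fact `Sjostrand2007_Thm_3_1`:
for `π` avoiding `4231`, `35142`, `42513`, `351624`, the rook configurations on the right hull
`λ(π) ∖ μ(π)` are exactly the permutations `σ ≤ π` (rank criterion). The inclusion
`[id, π] ⊆ 𝔖(λ ∖ μ)` holds for every `π` (rank criterion at the rook, and its south-west form);
the converse is the extremal/case argument of the printed proof (§4: the set `L`, a maximal
square `(i_max, j_max)`, two witnesses, and the four cases of Gasharov–Reiner, Thm 4.2).
[cite: Sjostrand2007, Thm 3.1] -/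
theorem Sjostrand2007_Thm_3_1_holds : Sjostrand2007_Thm_3_1 := by
  intro n π h1 h2 h3 h4
  refine ⟨(univ.filter fun q : Fin n × Fin n => ∃ c, q.1 ≤ c ∧ π c ≤ q.2),
    (univ.filter fun q : Fin n × Fin n => ∀ c, c ≤ q.1 → π c < q.2),
    isRightAlignedFerrers_hullOuter π, isRightAlignedFerrers_hullInner π,
    hullInner_subset_hullOuter π, fun σ => ⟨fun hσ => ?_, fun hle a => mem_board_of_bruhatLE hle a⟩⟩
  by_contra hne
  rcases pattern_of_not_bruhatLE π σ (fun a => (mem_board_iff π a (σ a)).mp (hσ a)) hne with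
    h | h | h | h
  · exact h1 h
  · exact h2 h
  · exact h3 h
  · exact h4 h

end Literature.Combinatorics.Enumerative
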